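import Mathlib
import Literature.Geometry.Symplectic.StandardEnd

/-!
# Stub `stub_chartTames` of line `Sketch` for crux `TameOrBrodyR4` (stmt-SmoothPoincare4-7826, route SullivanDual)

**A pencil chart tames** (step S5 of the anchored-pencils line, idea card
`Cruxes/TameOrBrodyR4/Ideas/anchored-pencils.md`, skeleton `Cruxes/TameOrBrodyR4/Lines/Sketch.lean`;
the card's `twoPencil_tames`). Write `ℝ⁴ = ℂ_c × ℂ_b` with coordinates `0, 1` spanning the plane
`L` and `2, 3` spanning the plane `H`, and let `ω₀(a, b) = a₀b₁ - a₁b₀ + a₂b₃ - a₃b₂` be the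
standard symplectic form (`Literature.Geometry.Symplectic.stdSymplecticForm`). Let `A` be a
bijective linear map of `ℝ⁴` (in the stub, `A = DΦ_x`) and `Jx` a linear map (in the stub,
`J x`) such that the pulled-back planes `T_A = A⁻¹ L` and `T_B = A⁻¹ H` are `Jx`-invariant and
`ω₀(A v, A Jx v) > 0` for every non-zero `v` in `T_A` and in `T_B`. Then `ω₀(A v, A Jx v) > 0`
for every `v ≠ 0`.

Proof (fully formal below). Split `y = A v` as `y = y_L + y_H` with `y_L = (y₀, y₁, 0, 0) ∈ L`,
`y_H = (0, 0, y₂, y₃) ∈ H`; by surjectivity pick `v_L, v_H` with `A v_L = y_L`, `A v_H = y_H`, so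
`v = v_L + v_H` by injectivity, `v_L ∈ T_A`, `v_H ∈ T_B`, hence `Jx v_L ∈ T_A`, `Jx v_H ∈ T_B`.
Since `ω₀ = dx₀ ∧ dx₁ + dx₂ ∧ dx₃` has no cross terms between `L` and `H`,
`ω₀(A v, A Jx v) = ω₀(A v_L, A Jx v_L) + ω₀(A v_H, A Jx v_H)`, and each summand is `> 0` when
`v_L ≠ 0` resp. `v_H ≠ 0`; if one of them vanishes, `v` itself lies in `T_B` resp. `T_A` and the
hypothesis applies directly. Reference: C. Wendl, *Holomorphic Curves in Low Dimensions*
(Springer LNM 2216, 2018), proof of Thm 6.8 ("`σ₁ ⊕ σ₂` also tames `J`").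
-/

open scoped ContDiff Topology InnerProductSpace
open Filter Literature.Geometry.Symplectic

-- the registered namespace `Summit.SmoothPoincare4.SmoothPoincare4.…` repeats a component
set_option linter.dupNamespace false

namespace Summit.SmoothPoincare4.SmoothPoincare4.Cruxes.TameOrBrodyR4.Sketch.ChartTames

/-- `ω₀` has no cross terms between the planes `L = {y₂ = y₃ = 0}` and `H = {y₀ = y₁ = 0}`:
for `a, b ∈ L` and `c, d ∈ H`, `ω₀(a + c, b + d) = ω₀(a, b) + ω₀(c, d)`. -/
theorem stdSymplecticForm_add_add_of_planes (a b c d : EuclideanSpace ℝ (Fin 4))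
    (ha2 : a 2 = 0) (ha3 : a 3 = 0) (hb2 : b 2 = 0) (hb3 : b 3 = 0)
    (hc0 : c 0 = 0) (hc1 : c 1 = 0) (hd0 : d 0 = 0) (hd1 : d 1 = 0) :
    stdSymplecticForm (a + c) (b + d) = stdSymplecticForm a b + stdSymplecticForm c d := by
  simp only [stdSymplecticForm, PiLp.add_apply, ha2, ha3, hb2, hb3, hc0, hc1, hd0, hd1]
  ring

/-- **Two pencils tame (pointwise linear algebra; the card's `twoPencil_tames`).** If `A` is a
bijective linear map of `ℝ⁴`, the planes `A⁻¹ L` (`(A v)₂ = (A v)₃ = 0`) and `A⁻¹ H`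
(`(A v)₀ = (A v)₁ = 0`) are `Jx`-invariant, and `ω₀(A v, A Jx v) > 0` for non-zero `v` in either
plane, then `ω₀(A v, A Jx v) > 0` for every `v ≠ 0`. -/
theorem twoPencil_tames
    (A Jx : EuclideanSpace ℝ (Fin 4) →L[ℝ] EuclideanSpace ℝ (Fin 4))
    (hbij : Function.Bijective A)
    (hA : ∀ v, A v 2 = 0 → A v 3 = 0 → A (Jx v) 2 = 0 ∧ A (Jx v) 3 = 0)
    (hB : ∀ v, A v 0 = 0 → A v 1 = 0 → A (Jx v) 0 = 0 ∧ A (Jx v) 1 = 0)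
    (hposA : ∀ v, v ≠ 0 → A v 2 = 0 → A v 3 = 0 → 0 < stdSymplecticForm (A v) (A (Jx v)))
    (hposB : ∀ v, v ≠ 0 → A v 0 = 0 → A v 1 = 0 → 0 < stdSymplecticForm (A v) (A (Jx v)))
    (v : EuclideanSpace ℝ (Fin 4)) (hv : v ≠ 0) :
    0 < stdSymplecticForm (A v) (A (Jx v)) := by
  -- split `A v = y_L + y_H` along the two coordinate planes and pull the pieces back by `A`
  obtain ⟨vL, hvL⟩ := hbij.2 (WithLp.toLp 2 ![A v 0, A v 1, 0, 0])
  obtain ⟨vH, hvH⟩ := hbij.2 (WithLp.toLp 2 ![0, 0, A v 2, A v 3])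
  have hsum : v = vL + vH := by
    apply hbij.1
    rw [map_add, hvL, hvH]
    ext i
    fin_cases i <;> simp
  have hvL2 : A vL 2 = 0 := by rw [hvL]; simp
  have hvL3 : A vL 3 = 0 := by rw [hvL]; simp
  have hvH0 : A vH 0 = 0 := by rw [hvH]; simp
  have hvH1 : A vH 1 = 0 := by rw [hvH]; simp
  -- degenerate splittings: `v` itself lies in one of the two planes
  by_cases hL0 : vL = 0
  · have e : v = vH := by rw [hsum, hL0, zero_add]
    subst e
    exact hposB _ hv hvH0 hvH1
  by_cases hH0 : vH = 0
  · have e : v = vL := by rw [hsum, hH0, add_zero]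
    subst e
    exact hposA _ hv hvL2 hvL3
  -- generic case: no cross terms, both summands positive
  obtain ⟨hJL2, hJL3⟩ := hA vL hvL2 hvL3
  obtain ⟨hJH0, hJH1⟩ := hB vH hvH0 hvH1
  have key : stdSymplecticForm (A v) (A (Jx v)) =
      stdSymplecticForm (A vL) (A (Jx vL)) + stdSymplecticForm (A vH) (A (Jx vH)) := by
    rw [hsum, map_add, map_add, map_add]
    exact stdSymplecticForm_add_add_of_planes _ _ _ _ hvL2 hvL3 hJL2 hJL3 hvH0 hvH1 hJH0 hJH1
  rw [key]
  exact add_pos (hposA vL hL0 hvL2 hvL3) (hposB vH hH0 hvH0 hvH1)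

end Summit.SmoothPoincare4.SmoothPoincare4.Cruxes.TameOrBrodyR4.Sketch.ChartTames

namespace Summit.SmoothPoincare4.SmoothPoincare4.Cruxes.TameOrBrodyR4.Sketch

/-- **Registered stub `stub_chartTames` (S5) of line `Sketch`, crux `TameOrBrodyR4`: a pencil
chart tames.** If `DΦ_x` is bijective, the two coordinate planes pulled back by `DΦ_x` are
`J`-invariant and `Φ^*ω₀(v, Jv) > 0` on each of them, then `Φ^*ω₀(v, Jv) > 0` for every `v ≠ 0`
(pointwise `ChartTames.twoPencil_tames` with `A = DΦ_x`, `Jx = J x`). Wendl, *Holomorphic Curves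
in Low Dimensions*, proof of Thm 6.8. -/
theorem stub_chartTames
    (J : EuclideanSpace ℝ (Fin 4) → EuclideanSpace ℝ (Fin 4) →L[ℝ] EuclideanSpace ℝ (Fin 4))
    (Φ : EuclideanSpace ℝ (Fin 4) → EuclideanSpace ℝ (Fin 4))
    (hbij : ∀ x, Function.Bijective (fderiv ℝ Φ x))
    (hA : ∀ x v, fderiv ℝ Φ x v 2 = 0 → fderiv ℝ Φ x v 3 = 0 →
      fderiv ℝ Φ x (J x v) 2 = 0 ∧ fderiv ℝ Φ x (J x v) 3 = 0)
    (hB : ∀ x v, fderiv ℝ Φ x v 0 = 0 → fderiv ℝ Φ x v 1 = 0 →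
      fderiv ℝ Φ x (J x v) 0 = 0 ∧ fderiv ℝ Φ x (J x v) 1 = 0)
    (hposA : ∀ x v, v ≠ 0 → fderiv ℝ Φ x v 2 = 0 → fderiv ℝ Φ x v 3 = 0 →
      0 < stdSymplecticForm (fderiv ℝ Φ x v) (fderiv ℝ Φ x (J x v)))
    (hposB : ∀ x v, v ≠ 0 → fderiv ℝ Φ x v 0 = 0 → fderiv ℝ Φ x v 1 = 0 →
      0 < stdSymplecticForm (fderiv ℝ Φ x v) (fderiv ℝ Φ x (J x v))) :
    ∀ x v : EuclideanSpace ℝ (Fin 4), v ≠ 0 →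
      0 < stdSymplecticForm (fderiv ℝ Φ x v) (fderiv ℝ Φ x (J x v)) :=
  fun x v hv =>
    ChartTames.twoPencil_tames (fderiv ℝ Φ x) (J x) (hbij x) (hA x) (hB x) (hposA x) (hposB x)
      v hv

end Summit.SmoothPoincare4.SmoothPoincare4.Cruxes.TameOrBrodyR4.Sketch
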